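import Summits.NavierStokesRegularity.NavierStokesRegularity.Theorems.PerpetualPumpThesisBilinearOperatorForm

/-!
# Stub U (`uniqueness`) for `PerpetualPump.Thesis`, part I: the `L² × H¹⁰ × H¹` bound for the
# averaged form

Support file (part 1 of the stub `uniqueness` of line `SketchIdeator2`, crux
stmt-NavierStokesRegularity-1832). Uniqueness of `H¹⁰_df`-mild solutions of Tao's averaged
Navier–Stokes equation (T. Tao, J. Amer. Math. Soc. 29 (2016), arXiv:1402.0290v3, §1.1 (1.9),
(1.12)–(1.15)) is an `L²`-energy/Grönwall argument on the difference of two solutions, which needs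
the duality form `⟨B̃(f,g), h⟩ = 𝒜.form f g h` bounded with one bilinear argument measured in `L²`:
`|⟨B̃(f,g), h⟩| + |⟨B̃(g,f), h⟩| ≤ K(𝒜) ‖f‖_{L²} ‖g‖_{H¹⁰} ‖h‖_{H¹}` (`exists_enorm_form_le_one`).
For the Euler form (1.3) this is `|⟨B(f,g), h⟩| ≤ 3π C₉ ‖f‖_{L²} ‖g‖_{H¹⁰} ‖h‖_{H¹}`,
`C₉ = (∫_{ℝ³} (1+|ξ|²)^{-9})^{1/2}` (`enorm_eulerForm_le_one`), from
`|Λ_{ξ₁,ξ₂}(X₁,X₂,X₃)| ≤ (|ξ₁|+|ξ₂|)|X₁||X₂||X₃|`, the weight inequality `|ξ₁| + |ξ₂| ≤ 3 ⟨ξ₂⟩⟨ξ₃⟩`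
(`ξ₃ = -ξ₁-ξ₂`, `⟨ξ⟩ = √(1+|ξ|²)`: no derivative on the `L²` slot), Tonelli, Cauchy–Schwarz in
the inner variable and `‖⟨ξ⟩ĝ‖₁ ≤ C₉ ‖g‖_{H¹⁰}`; then the tree's slot bounds on `L²`, `H¹⁰`, `H¹`
and the moment bound `𝔼 ‖m₁‖₀‖m₂‖₀‖m₃‖₀ < ∞`, as in part III of stub B.

## References

* T. Tao, J. Amer. Math. Soc. 29 (2016), 601–674, arXiv:1402.0290v3, §1.1 (1.3)–(1.4),
  (1.10)–(1.15).
-/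

noncomputable section

open MeasureTheory Set Filter Topology FourierTransform Complex
open scoped ENNReal NNReal

set_option linter.dupNamespace false

namespace Summit.NavierStokesRegularity.NavierStokesRegularity.Theorems.PerpetualPumpThesis.U

open Literature.Analysis.FluidPDE Literature.Analysis.FluidPDE.Tao2016
open Literature.Analysis.FunctionSpaces (eFourierSobolevNorm)
open Summit.NavierStokesRegularity.NavierStokesRegularity.Theorems.PerpetualPumpThesis.B
  (jb_sq norm_le_jb continuous_jb lintegral_mul_comp_sub_le)

/-! ### The weight inequality and the pointwise bound for `Λ` -/

/-- `1 ≤ ⟨ξ⟩`. -/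
theorem one_le_jb (ξ : EuclideanSpace ℝ (Fin 3)) : 1 ≤ √(1 + ‖ξ‖ ^ 2) :=
  Real.one_le_sqrt.2 (le_add_of_nonneg_right (sq_nonneg _))

/-- **The weight inequality** with no derivative on the first slot:
`|ξ₁| + |ξ₂| ≤ 3 ⟨ξ₂⟩ ⟨ξ₃⟩`, `ξ₃ = -ξ₁-ξ₂` (since `|ξ₁| ≤ |ξ₂| + |ξ₃|` and `⟨·⟩ ≥ max(1, |·|)`). -/
theorem weight_ineq_one (ξ₁ ξ₂ : EuclideanSpace ℝ (Fin 3)) :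
    ‖ξ₁‖ + ‖ξ₂‖ ≤ 3 * (√(1 + ‖ξ₂‖ ^ 2) * √(1 + ‖-ξ₁ - ξ₂‖ ^ 2)) := by
  have h1 : ‖ξ₁‖ ≤ ‖ξ₂‖ + ‖-ξ₁ - ξ₂‖ := by
    have h : ξ₂ + (-ξ₁ - ξ₂) = -ξ₁ := by abel
    calc ‖ξ₁‖ = ‖-ξ₁‖ := (norm_neg ξ₁).symm
      _ = ‖ξ₂ + (-ξ₁ - ξ₂)‖ := by rw [h]
      _ ≤ ‖ξ₂‖ + ‖-ξ₁ - ξ₂‖ := norm_add_le _ _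
  have ha := one_le_jb ξ₂
  have hb := one_le_jb (-ξ₁ - ξ₂)
  have ha' := norm_le_jb ξ₂
  have hb' := norm_le_jb (-ξ₁ - ξ₂)
  have hA : √(1 + ‖ξ₂‖ ^ 2) ≤ √(1 + ‖ξ₂‖ ^ 2) * √(1 + ‖-ξ₁ - ξ₂‖ ^ 2) :=
    le_mul_of_one_le_right (zero_le_one.trans ha) hb
  have hB : √(1 + ‖-ξ₁ - ξ₂‖ ^ 2) ≤ √(1 + ‖ξ₂‖ ^ 2) * √(1 + ‖-ξ₁ - ξ₂‖ ^ 2) :=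
    le_mul_of_one_le_left (zero_le_one.trans hb) ha
  linarith

/-- **Pointwise bound for Tao's symbol (1.4) with the `L²` slot underived**:
`|Λ_{ξ₁,ξ₂}(X₁,X₂,X₃)| ≤ 3 |X₁| (⟨ξ₂⟩|X₂|) (⟨ξ₃⟩|X₃|)`. -/
theorem norm_Λ_le_one (ξ₁ ξ₂ : EuclideanSpace ℝ (Fin 3)) (X₁ X₂ X₃ : EuclideanSpace ℂ (Fin 3)) :
    ‖Λ ξ₁ ξ₂ X₁ X₂ X₃‖ ≤
      3 * (‖X₁‖ * ((√(1 + ‖ξ₂‖ ^ 2) * ‖X₂‖) * (√(1 + ‖-ξ₁ - ξ₂‖ ^ 2) * ‖X₃‖))) := by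
  calc ‖Λ ξ₁ ξ₂ X₁ X₂ X₃‖
      ≤ ‖X₁‖ * ‖ξ₂‖ * (‖X₂‖ * ‖X₃‖) + ‖X₂‖ * ‖ξ₁‖ * (‖X₁‖ * ‖X₃‖) := norm_Λ_le ξ₁ ξ₂ X₁ X₂ X₃
    _ = (‖ξ₁‖ + ‖ξ₂‖) * (‖X₁‖ * ‖X₂‖ * ‖X₃‖) := by ring
    _ ≤ 3 * (√(1 + ‖ξ₂‖ ^ 2) * √(1 + ‖-ξ₁ - ξ₂‖ ^ 2)) * (‖X₁‖ * ‖X₂‖ * ‖X₃‖) :=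
        mul_le_mul_of_nonneg_right (weight_ineq_one ξ₁ ξ₂) (by positivity)
    _ = _ := by ring

/-- The same bound in `ℝ≥0∞`, with the weights `⟨ξ⟩` as `ENNReal.ofReal (√(1 + ‖ξ‖ ^ 2))`. -/
theorem enorm_Λ_le_one (ξ₁ ξ₂ : EuclideanSpace ℝ (Fin 3)) (X₁ X₂ X₃ : EuclideanSpace ℂ (Fin 3)) :
    ‖Λ ξ₁ ξ₂ X₁ X₂ X₃‖ₑ ≤
      3 * (‖X₁‖ₑ * ((ENNReal.ofReal (√(1 + ‖ξ₂‖ ^ 2)) * ‖X₂‖ₑ) *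
        (ENNReal.ofReal (√(1 + ‖-ξ₁ - ξ₂‖ ^ 2)) * ‖X₃‖ₑ))) := by
  rw [← ofReal_norm (Λ ξ₁ ξ₂ X₁ X₂ X₃)]
  refine (ENNReal.ofReal_le_ofReal (norm_Λ_le_one ξ₁ ξ₂ X₁ X₂ X₃)).trans_eq ?_
  rw [ENNReal.ofReal_mul (by positivity), ENNReal.ofReal_mul (by positivity),
    ENNReal.ofReal_mul (by positivity), ENNReal.ofReal_mul (by positivity),
    ENNReal.ofReal_mul (by positivity), ENNReal.ofReal_ofNat, ofReal_norm, ofReal_norm, ofReal_norm]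

/-- `⟨ξ⟩² = (1+|ξ|²)¹` for the `ℝ≥0∞` weight: its square is the `H¹` weight. -/
theorem wOne_sq (ξ : EuclideanSpace ℝ (Fin 3)) :
    ENNReal.ofReal (√(1 + ‖ξ‖ ^ 2)) ^ 2 = ENNReal.ofReal ((1 + ‖ξ‖ ^ 2) ^ (1 : ℝ)) := by
  rw [← ENNReal.ofReal_pow (Real.sqrt_nonneg _), jb_sq, Real.rpow_one]

/-- The weight `⟨ξ⟩` is measurable. -/
theorem measurable_wOne :
    Measurable fun ξ : EuclideanSpace ℝ (Fin 3) => ENNReal.ofReal (√(1 + ‖ξ‖ ^ 2)) :=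
  continuous_jb.measurable.ennreal_ofReal

/-! ### The trilinear estimate with an `L²` slot -/

/-- **The trilinear estimate for (1.3) with the first slot in `L²`**: for measurable fields
`f, g, h` on frequency space,
`∫∫ |Λ(f(ξ₁), g(ξ₂), h(-ξ₁-ξ₂))| ≤ 3 ‖⟨ξ⟩g‖₁ ‖f‖₂ ‖⟨ξ⟩h‖₂`
(Tonelli with `ξ₁` inside, Cauchy–Schwarz in `ξ₁`, translation invariance). -/
theorem lintegral_enorm_Λ_le_one {f g h : EuclideanSpace ℝ (Fin 3) → EuclideanSpace ℂ (Fin 3)}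
    (hf : AEStronglyMeasurable f volume) (hg : AEStronglyMeasurable g volume)
    (hh : AEStronglyMeasurable h volume) :
    ∫⁻ p : EuclideanSpace ℝ (Fin 3) × EuclideanSpace ℝ (Fin 3),
        ‖Λ p.1 p.2 (f p.1) (g p.2) (h (-p.1 - p.2))‖ₑ ≤
      3 * ((∫⁻ ξ, ENNReal.ofReal (√(1 + ‖ξ‖ ^ 2)) * ‖g ξ‖ₑ) *
        ((∫⁻ ξ, ‖f ξ‖ₑ ^ 2) ^ (1 / 2 : ℝ) *
          (∫⁻ ξ, (ENNReal.ofReal (√(1 + ‖ξ‖ ^ 2)) * ‖h ξ‖ₑ) ^ 2) ^ (1 / 2 : ℝ))) := by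
  rw [Measure.volume_eq_prod]
  set μ : Measure (EuclideanSpace ℝ (Fin 3)) := volume with hμ
  -- the weighted densities
  set G : EuclideanSpace ℝ (Fin 3) → ℝ≥0∞ :=
    fun ξ => ENNReal.ofReal (√(1 + ‖ξ‖ ^ 2)) * ‖g ξ‖ₑ with hGdef
  set H : EuclideanSpace ℝ (Fin 3) → ℝ≥0∞ :=
    fun ξ => ENNReal.ofReal (√(1 + ‖ξ‖ ^ 2)) * ‖h ξ‖ₑ with hHdef
  have hFm : AEMeasurable (fun ξ => ‖f ξ‖ₑ) μ := hf.enorm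
  have hGm : AEMeasurable G μ := measurable_wOne.aemeasurable.mul hg.enorm
  have hHm : AEMeasurable H μ := measurable_wOne.aemeasurable.mul hh.enorm
  -- measurability of the pieces on the product space
  have hf1 : AEMeasurable (fun p : EuclideanSpace ℝ (Fin 3) × EuclideanSpace ℝ (Fin 3) => ‖f p.1‖ₑ)
      (μ.prod μ) :=
    (hf.comp_quasiMeasurePreserving Measure.quasiMeasurePreserving_fst).enorm
  have hG2 : AEMeasurable (fun p : EuclideanSpace ℝ (Fin 3) × EuclideanSpace ℝ (Fin 3) => G p.2)
      (μ.prod μ) :=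
    hGm.comp_quasiMeasurePreserving Measure.quasiMeasurePreserving_snd
  have hH3 : AEMeasurable (fun p : EuclideanSpace ℝ (Fin 3) × EuclideanSpace ℝ (Fin 3) =>
      H (-p.1 - p.2)) (μ.prod μ) :=
    hHm.comp_quasiMeasurePreserving quasiMeasurePreserving_neg_fst_sub_snd
  -- the Tonelli majorant
  set T : EuclideanSpace ℝ (Fin 3) × EuclideanSpace ℝ (Fin 3) → ℝ≥0∞ :=
    fun p => 3 * (G p.2 * (‖f p.1‖ₑ * H (-p.1 - p.2))) with hT
  have hTm : AEMeasurable T (μ.prod μ) := (hG2.mul (hf1.mul hH3)).const_mul _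
  set WF : ℝ≥0∞ := (∫⁻ ξ, ‖f ξ‖ₑ ^ 2 ∂μ) ^ (1 / 2 : ℝ) with hWF
  set WH : ℝ≥0∞ := (∫⁻ ξ, H ξ ^ 2 ∂μ) ^ (1 / 2 : ℝ) with hWH
  have h3 : (3 : ℝ≥0∞) ≠ ∞ := ENNReal.ofNat_ne_top
  have hGfin : ∀ ξ, G ξ ≠ ∞ := fun ξ => ENNReal.mul_ne_top ENNReal.ofReal_ne_top enorm_ne_top
  -- integrate `ξ₁` inside
  have h1 : ∫⁻ p, T p ∂(μ.prod μ) ≤ 3 * ((∫⁻ ξ, G ξ ∂μ) * (WF * WH)) := by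
    rw [lintegral_prod_symm _ hTm]
    calc ∫⁻ ξ₂, ∫⁻ ξ₁, T (ξ₁, ξ₂) ∂μ ∂μ
        = ∫⁻ ξ₂, 3 * (G ξ₂ * ∫⁻ ξ₁, ‖f ξ₁‖ₑ * H (-ξ₂ - ξ₁) ∂μ) ∂μ := by
          refine lintegral_congr fun ξ₂ => ?_
          simp only [hT]
          rw [lintegral_const_mul' _ _ h3, lintegral_const_mul' _ _ (hGfin ξ₂)]
          congr 2
          refine lintegral_congr fun ξ₁ => ?_
          rw [show -ξ₁ - ξ₂ = -ξ₂ - ξ₁ by abel]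
      _ ≤ ∫⁻ ξ₂, 3 * (G ξ₂ * (WF * WH)) ∂μ := by
          refine lintegral_mono fun ξ₂ => mul_le_mul' le_rfl (mul_le_mul' le_rfl ?_)
          exact lintegral_mul_comp_sub_le hFm hHm (-ξ₂)
      _ = 3 * ((∫⁻ ξ, G ξ ∂μ) * (WF * WH)) := by
          rw [lintegral_const_mul' _ _ h3, lintegral_mul_const'' _ hGm]
  calc ∫⁻ p, ‖Λ p.1 p.2 (f p.1) (g p.2) (h (-p.1 - p.2))‖ₑ ∂(μ.prod μ)
      ≤ ∫⁻ p, T p ∂(μ.prod μ) := by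
        refine lintegral_mono fun p => ?_
        rw [hT]
        convert enorm_Λ_le_one p.1 p.2 (f p.1) (g p.2) (h (-p.1 - p.2)) using 1
        simp only [hGdef, hHdef]
        ring
    _ ≤ 3 * ((∫⁻ ξ, G ξ ∂μ) * (WF * WH)) := h1

/-! ### `H¹⁰(ℝ³) ⊂ 𝓕L¹` with one extra weight: the constant `C₉ = (∫ (1+|ξ|²)^{-9})^{1/2}` -/

/-- `∫_{ℝ³} (1+|ξ|²)^{-9} dξ < ∞` (Mathlib's `integrable_rpow_neg_one_add_norm_sq`, `18 > 3`). -/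
theorem lintegral_sobolevWeight_neg_nine_lt_top :
    ∫⁻ ξ : EuclideanSpace ℝ (Fin 3), ENNReal.ofReal ((1 + ‖ξ‖ ^ 2) ^ (-9 : ℝ)) < ∞ := by
  have h := integrable_rpow_neg_one_add_norm_sq (E := EuclideanSpace ℝ (Fin 3))
    (μ := (volume : Measure (EuclideanSpace ℝ (Fin 3)))) (r := 18)
    (by rw [finrank_euclideanSpace, Fintype.card_fin]; norm_num)
  have h' : Integrable (fun ξ : EuclideanSpace ℝ (Fin 3) => (1 + ‖ξ‖ ^ 2) ^ (-9 : ℝ)) := by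
    refine h.congr (Eventually.of_forall fun ξ => ?_)
    norm_num
  exact h'.lintegral_lt_top

/-- **`‖⟨ξ⟩ f‖₁ ≤ C₉ (∫ (1+|ξ|²)^{10} |f|²)^{1/2}`** (Cauchy–Schwarz with `⟨ξ⟩ = ⟨ξ⟩^{-9} · ⟨ξ⟩^{10}`);
for `f = ĝ` the second factor is `‖g‖_{H¹⁰}`. -/
theorem lintegral_wOne_enorm_le {f : EuclideanSpace ℝ (Fin 3) → EuclideanSpace ℂ (Fin 3)}
    (hf : AEStronglyMeasurable f volume) :
    ∫⁻ ξ, ENNReal.ofReal (√(1 + ‖ξ‖ ^ 2)) * ‖f ξ‖ₑ ≤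
      (∫⁻ ξ : EuclideanSpace ℝ (Fin 3), ENNReal.ofReal ((1 + ‖ξ‖ ^ 2) ^ (-9 : ℝ))) ^ (1 / 2 : ℝ) *
        sobolevWeightIntegral 10 f ^ (1 / 2 : ℝ) := by
  have hw : ∀ s : ℝ, Measurable fun ξ : EuclideanSpace ℝ (Fin 3) =>
      ENNReal.ofReal ((1 + ‖ξ‖ ^ 2) ^ s) := measurable_sobolevWeight
  have hsq : ∀ (s : ℝ) (ξ : EuclideanSpace ℝ (Fin 3)),
      ENNReal.ofReal ((1 + ‖ξ‖ ^ 2) ^ s) ^ (2 : ℝ) = ENNReal.ofReal ((1 + ‖ξ‖ ^ 2) ^ (2 * s)) := by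
    intro s ξ
    have h0 : 0 < 1 + ‖ξ‖ ^ 2 := by positivity
    rw [ENNReal.ofReal_rpow_of_nonneg (Real.rpow_nonneg h0.le _) (by norm_num), ← Real.rpow_mul h0.le,
      mul_comm]
  have hsplit : ∀ ξ : EuclideanSpace ℝ (Fin 3), ENNReal.ofReal (√(1 + ‖ξ‖ ^ 2)) =
      ENNReal.ofReal ((1 + ‖ξ‖ ^ 2) ^ (-(9 / 2) : ℝ)) * ENNReal.ofReal ((1 + ‖ξ‖ ^ 2) ^ (5 : ℝ)) := by
    intro ξ
    have h0 : 0 < 1 + ‖ξ‖ ^ 2 := by positivity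
    rw [← ENNReal.ofReal_mul (Real.rpow_nonneg h0.le _), ← Real.rpow_add h0, Real.sqrt_eq_rpow]
    norm_num
  unfold sobolevWeightIntegral
  calc ∫⁻ ξ, ENNReal.ofReal (√(1 + ‖ξ‖ ^ 2)) * ‖f ξ‖ₑ
      = ∫⁻ ξ, ENNReal.ofReal ((1 + ‖ξ‖ ^ 2) ^ (-(9 / 2) : ℝ)) *
          (ENNReal.ofReal ((1 + ‖ξ‖ ^ 2) ^ (5 : ℝ)) * ‖f ξ‖ₑ) := by
        refine lintegral_congr fun ξ => ?_
        rw [← mul_assoc, ← hsplit]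
    _ ≤ (∫⁻ ξ, ENNReal.ofReal ((1 + ‖ξ‖ ^ 2) ^ (-(9 / 2) : ℝ)) ^ (2 : ℝ)) ^ (1 / (2 : ℝ)) *
          (∫⁻ ξ, (ENNReal.ofReal ((1 + ‖ξ‖ ^ 2) ^ (5 : ℝ)) * ‖f ξ‖ₑ) ^ (2 : ℝ)) ^ (1 / (2 : ℝ)) :=
        ENNReal.lintegral_mul_le_Lp_mul_Lq volume Real.HolderConjugate.two_two (hw _).aemeasurable
          ((hw _).aemeasurable.mul hf.enorm)
    _ = _ := by
        congr 2
        · refine lintegral_congr fun ξ => ?_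
          rw [hsq]
          norm_num
        · refine lintegral_congr fun ξ => ?_
          rw [ENNReal.mul_rpow_of_nonneg _ _ (by norm_num : (0 : ℝ) ≤ 2), hsq, ENNReal.rpow_two]
          norm_num

/-! ### Specialisation to Fourier transforms: `L² × H¹⁰ × H¹` -/

/-- `‖⟨ξ⟩ ĝ‖²_{L²} = ∫ (1+|ξ|²)¹ |ĝ|²`: the weighted `L²` norm is the `H¹` integral. -/
theorem lintegral_wOne_mul_sq (g : EuclideanSpace ℝ (Fin 3) → EuclideanSpace ℂ (Fin 3)) :
    ∫⁻ ξ, (ENNReal.ofReal (√(1 + ‖ξ‖ ^ 2)) * ‖g ξ‖ₑ) ^ 2 = sobolevWeightIntegral 1 g := by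
  unfold sobolevWeightIntegral
  refine lintegral_congr fun ξ => ?_
  rw [mul_pow, wOne_sq]

/-- **Absolute convergence of (1.3) on `L² × H¹⁰ × H¹`**: for `f, g, h ∈ L²`,
`∫∫ |Λ(f̂(ξ₁), ĝ(ξ₂), ĥ(-ξ₁-ξ₂))| ≤ 3 C₉ ‖f‖_{L²} ‖g‖_{H¹⁰} ‖h‖_{H¹}`. -/
theorem lintegral_enorm_Λ_fourierFn_le_one (f g h : L2C) :
    ∫⁻ p : EuclideanSpace ℝ (Fin 3) × EuclideanSpace ℝ (Fin 3),
        ‖Λ p.1 p.2 (fourierFn f p.1) (fourierFn g p.2) (fourierFn h (-p.1 - p.2))‖ₑ ≤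
      3 * (∫⁻ ξ : EuclideanSpace ℝ (Fin 3), ENNReal.ofReal ((1 + ‖ξ‖ ^ 2) ^ (-9 : ℝ))) ^ (1 / 2 : ℝ) *
        ‖f‖ₑ * eFourierSobolevNorm 10 g * eFourierSobolevNorm 1 h := by
  refine (lintegral_enorm_Λ_le_one (aestronglyMeasurable_fourierFn f)
    (aestronglyMeasurable_fourierFn g) (aestronglyMeasurable_fourierFn h)).trans ?_
  rw [lintegral_wOne_mul_sq, lintegral_enorm_sq_fourierFn_rpow_eq, ← eFourierSobolevNorm_eq]
  have hg := lintegral_wOne_enorm_le (aestronglyMeasurable_fourierFn g)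
  rw [← eFourierSobolevNorm_eq] at hg
  calc 3 * ((∫⁻ ξ, ENNReal.ofReal (√(1 + ‖ξ‖ ^ 2)) * ‖fourierFn g ξ‖ₑ) * (‖f‖ₑ * eFourierSobolevNorm 1 h))
      ≤ 3 * (((∫⁻ ξ : EuclideanSpace ℝ (Fin 3), ENNReal.ofReal ((1 + ‖ξ‖ ^ 2) ^ (-9 : ℝ))) ^ (1 / 2 : ℝ) *
          eFourierSobolevNorm 10 g) * (‖f‖ₑ * eFourierSobolevNorm 1 h)) := by gcongr
    _ = _ := by ring

/-- **The Euler form is bounded on `L² × H¹⁰ × H¹`**: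
`|⟨B(f,g), h⟩| ≤ 3π C₉ ‖f‖_{L²} ‖g‖_{H¹⁰} ‖h‖_{H¹}` for all `f, g, h ∈ L²(ℝ³; ℂ³)`. -/
theorem enorm_eulerForm_le_one (f g h : L2C) :
    ‖eulerForm f g h‖ₑ ≤ ENNReal.ofReal Real.pi *
      (3 * (∫⁻ ξ : EuclideanSpace ℝ (Fin 3), ENNReal.ofReal ((1 + ‖ξ‖ ^ 2) ^ (-9 : ℝ))) ^ (1 / 2 : ℝ) *
        ‖f‖ₑ * eFourierSobolevNorm 10 g * eFourierSobolevNorm 1 h) := by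
  have hπ : ‖-((Real.pi : ℂ) * I)‖ₑ = ENNReal.ofReal Real.pi := by
    rw [enorm_neg, enorm_mul, ← ofReal_norm, ← ofReal_norm, Complex.norm_I, ENNReal.ofReal_one,
      mul_one, Complex.norm_real, Real.norm_of_nonneg Real.pi_pos.le]
  unfold eulerForm
  rw [enorm_mul, hπ]
  exact mul_le_mul' le_rfl ((enorm_integral_le_lintegral_enorm _).trans
    (lintegral_enorm_Λ_fourierFn_le_one f g h))

/-- The symmetric bound: `|⟨B(g,f), h⟩| ≤ 3π C₉ ‖f‖_{L²} ‖g‖_{H¹⁰} ‖h‖_{H¹}` (`B` is symmetric). -/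
theorem enorm_eulerForm_le_one' (f g h : L2C) :
    ‖eulerForm g f h‖ₑ ≤ ENNReal.ofReal Real.pi *
      (3 * (∫⁻ ξ : EuclideanSpace ℝ (Fin 3), ENNReal.ofReal ((1 + ‖ξ‖ ^ 2) ^ (-9 : ℝ))) ^ (1 / 2 : ℝ) *
        ‖f‖ₑ * eFourierSobolevNorm 10 g * eFourierSobolevNorm 1 h) := by
  rw [eulerForm_symm]
  exact enorm_eulerForm_le_one f g h

/-! ### Through the slots of (1.12) and the average (1.13) -/

/-- **Pointwise bound for the integrand of (1.13) on `L² × H¹⁰ × H¹`** (both orders of the two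
bilinear slots): if `λ_{i,θ} ≤ C` then, with `M = max(1, C)`,
`|⟨B(A₁f, A₂g), A₃h⟩|, |⟨B(A₁g, A₂f), A₃h⟩| ≤ 3π C₉ M¹⁰ M ‖f‖_{L²} ‖g‖_{H¹⁰} ‖h‖_{H¹} ‖m₁‖₀‖m₂‖₀‖m₃‖₀`. -/
theorem enorm_eulerForm_slot_le_one (𝒜 : AveragingDatum) {C : ℝ} (hC : ∀ i θ, 𝒜.lam i θ ≤ C)
    (f g h : L2C) (θ : 𝒜.Ω) :
    ‖eulerForm (𝒜.slot 0 θ f) (𝒜.slot 1 θ g) (𝒜.slot 2 θ h)‖ₑ ≤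
        ENNReal.ofReal Real.pi * (3 * (∫⁻ ξ : EuclideanSpace ℝ (Fin 3),
            ENNReal.ofReal ((1 + ‖ξ‖ ^ 2) ^ (-9 : ℝ))) ^ (1 / 2 : ℝ)) *
          ENNReal.ofReal (max 1 C ^ (10 : ℝ)) * ENNReal.ofReal (max 1 C ^ (1 : ℝ)) *
          (‖f‖ₑ * eFourierSobolevNorm 10 g * eFourierSobolevNorm 1 h) *
          (symbolSeminorm 0 (𝒜.m 0 θ) * symbolSeminorm 0 (𝒜.m 1 θ) * symbolSeminorm 0 (𝒜.m 2 θ)) ∧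
      ‖eulerForm (𝒜.slot 0 θ g) (𝒜.slot 1 θ f) (𝒜.slot 2 θ h)‖ₑ ≤
        ENNReal.ofReal Real.pi * (3 * (∫⁻ ξ : EuclideanSpace ℝ (Fin 3),
            ENNReal.ofReal ((1 + ‖ξ‖ ^ 2) ^ (-9 : ℝ))) ^ (1 / 2 : ℝ)) *
          ENNReal.ofReal (max 1 C ^ (10 : ℝ)) * ENNReal.ofReal (max 1 C ^ (1 : ℝ)) *
          (‖f‖ₑ * eFourierSobolevNorm 10 g * eFourierSobolevNorm 1 h) *
          (symbolSeminorm 0 (𝒜.m 0 θ) * symbolSeminorm 0 (𝒜.m 1 θ) * symbolSeminorm 0 (𝒜.m 2 θ)) := by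
  set 𝒟 := 𝒜.toComplex with h𝒟
  have hK : ∀ i, ENNReal.ofReal (max 1 (𝒜.lam i θ) ^ (10 : ℝ)) ≤ ENNReal.ofReal (max 1 C ^ (10 : ℝ)) :=
    fun i => ENNReal.ofReal_le_ofReal
      (Real.rpow_le_rpow (by positivity) (max_le_max le_rfl (hC i θ)) (by norm_num))
  have hK1 : ENNReal.ofReal (max 1 (𝒜.lam 2 θ) ^ (1 : ℝ)) ≤ ENNReal.ofReal (max 1 C ^ (1 : ℝ)) :=
    ENNReal.ofReal_le_ofReal
      (Real.rpow_le_rpow (by positivity) (max_le_max le_rfl (hC 2 θ)) (by norm_num))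
  have hL2 : ∀ (i : Fin 3) (x : L2C), ‖𝒜.slot i θ x‖ₑ ≤ symbolSeminorm 0 (𝒜.m i θ) * ‖x‖ₑ :=
    fun i x => 𝒟.enorm_slot_le i θ x
  have h10 : ∀ (i : Fin 3) (x : L2C), eFourierSobolevNorm 10 (𝒜.slot i θ x) ≤
      symbolSeminorm 0 (𝒜.m i θ) * (ENNReal.ofReal (max 1 C ^ (10 : ℝ)) * eFourierSobolevNorm 10 x) :=
    fun i x => by
      refine (𝒟.eFourierSobolevNorm_slot_le i θ (by norm_num : (0 : ℝ) ≤ 10) x).trans ?_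
      rw [mul_assoc]
      exact mul_le_mul' le_rfl (mul_le_mul' (hK i) le_rfl)
  have h1 : eFourierSobolevNorm 1 (𝒜.slot 2 θ h) ≤
      symbolSeminorm 0 (𝒜.m 2 θ) * (ENNReal.ofReal (max 1 C ^ (1 : ℝ)) * eFourierSobolevNorm 1 h) := by
    refine (𝒟.eFourierSobolevNorm_slot_le 2 θ (by norm_num : (0 : ℝ) ≤ 1) h).trans ?_
    rw [mul_assoc]
    exact mul_le_mul' le_rfl (mul_le_mul' hK1 le_rfl)
  constructor
  · have ha := hL2 0 f
    have hb := h10 1 g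
    calc ‖eulerForm (𝒜.slot 0 θ f) (𝒜.slot 1 θ g) (𝒜.slot 2 θ h)‖ₑ
        ≤ ENNReal.ofReal Real.pi * (3 * (∫⁻ ξ : EuclideanSpace ℝ (Fin 3),
            ENNReal.ofReal ((1 + ‖ξ‖ ^ 2) ^ (-9 : ℝ))) ^ (1 / 2 : ℝ) *
            ‖𝒜.slot 0 θ f‖ₑ * eFourierSobolevNorm 10 (𝒜.slot 1 θ g) *
            eFourierSobolevNorm 1 (𝒜.slot 2 θ h)) := enorm_eulerForm_le_one _ _ _
      _ ≤ ENNReal.ofReal Real.pi * (3 * (∫⁻ ξ : EuclideanSpace ℝ (Fin 3),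
            ENNReal.ofReal ((1 + ‖ξ‖ ^ 2) ^ (-9 : ℝ))) ^ (1 / 2 : ℝ) *
            (symbolSeminorm 0 (𝒜.m 0 θ) * ‖f‖ₑ) *
            (symbolSeminorm 0 (𝒜.m 1 θ) * (ENNReal.ofReal (max 1 C ^ (10 : ℝ)) * eFourierSobolevNorm 10 g)) *
            (symbolSeminorm 0 (𝒜.m 2 θ) * (ENNReal.ofReal (max 1 C ^ (1 : ℝ)) * eFourierSobolevNorm 1 h))) := by
          gcongr
      _ = _ := by ring
  · have ha := hL2 1 f
    have hb := h10 0 g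
    calc ‖eulerForm (𝒜.slot 0 θ g) (𝒜.slot 1 θ f) (𝒜.slot 2 θ h)‖ₑ
        ≤ ENNReal.ofReal Real.pi * (3 * (∫⁻ ξ : EuclideanSpace ℝ (Fin 3),
            ENNReal.ofReal ((1 + ‖ξ‖ ^ 2) ^ (-9 : ℝ))) ^ (1 / 2 : ℝ) *
            ‖𝒜.slot 1 θ f‖ₑ * eFourierSobolevNorm 10 (𝒜.slot 0 θ g) *
            eFourierSobolevNorm 1 (𝒜.slot 2 θ h)) := enorm_eulerForm_le_one' _ _ _
      _ ≤ ENNReal.ofReal Real.pi * (3 * (∫⁻ ξ : EuclideanSpace ℝ (Fin 3),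
            ENNReal.ofReal ((1 + ‖ξ‖ ^ 2) ^ (-9 : ℝ))) ^ (1 / 2 : ℝ) *
            (symbolSeminorm 0 (𝒜.m 1 θ) * ‖f‖ₑ) *
            (symbolSeminorm 0 (𝒜.m 0 θ) * (ENNReal.ofReal (max 1 C ^ (10 : ℝ)) * eFourierSobolevNorm 10 g)) *
            (symbolSeminorm 0 (𝒜.m 2 θ) * (ENNReal.ofReal (max 1 C ^ (1 : ℝ)) * eFourierSobolevNorm 1 h))) := by
          gcongr
      _ = _ := by ring

/-- **The `L² × H¹⁰ × H¹` bound for the averaged form** (both orders of the bilinear slots): for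
every averaging datum `𝒜` there is `K < ∞` with
`|⟨B̃(f,g), h⟩| ≤ K ‖f‖_{L²} ‖g‖_{H¹⁰} ‖h‖_{H¹}` and `|⟨B̃(g,f), h⟩| ≤ K ‖f‖_{L²} ‖g‖_{H¹⁰} ‖h‖_{H¹}`
for all `f ∈ L²`, `g` of finite `H¹⁰` norm and `h` of finite `H¹` norm (pointwise slot bound, then
the moment bound `𝔼 ‖m₁‖₀‖m₂‖₀‖m₃‖₀ < ∞` of (1.13)). This is the estimate that closes the
`L²`-Grönwall argument for the difference of two mild solutions. -/
theorem exists_enorm_form_le_one (𝒜 : AveragingDatum) :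
    ∃ K : ℝ≥0, ∀ f g h : L2C, eFourierSobolevNorm 10 g < ⊤ → eFourierSobolevNorm 1 h < ⊤ →
      ‖𝒜.form f g h‖ₑ ≤ (K : ℝ≥0∞) * ‖f‖ₑ * eFourierSobolevNorm 10 g * eFourierSobolevNorm 1 h ∧
      ‖𝒜.form g f h‖ₑ ≤ (K : ℝ≥0∞) * ‖f‖ₑ * eFourierSobolevNorm 10 g * eFourierSobolevNorm 1 h := by
  obtain ⟨C, hC⟩ := 𝒜.lam_bdd
  have hC' : ∀ i θ, 𝒜.lam i θ ≤ C := fun i θ => (hC i θ).2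
  set Kpt : ℝ≥0∞ := ENNReal.ofReal Real.pi * (3 * (∫⁻ ξ : EuclideanSpace ℝ (Fin 3),
      ENNReal.ofReal ((1 + ‖ξ‖ ^ 2) ^ (-9 : ℝ))) ^ (1 / 2 : ℝ)) *
    ENNReal.ofReal (max 1 C ^ (10 : ℝ)) * ENNReal.ofReal (max 1 C ^ (1 : ℝ)) with hKpt
  set S : ℝ≥0∞ := ∫⁻ θ, symbolSeminorm 0 (𝒜.m 0 θ) * symbolSeminorm 0 (𝒜.m 1 θ) *
    symbolSeminorm 0 (𝒜.m 2 θ) ∂𝒜.μ with hS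
  have hKpt_top : Kpt < ∞ :=
    ENNReal.mul_lt_top (ENNReal.mul_lt_top (ENNReal.mul_lt_top ENNReal.ofReal_lt_top
      (ENNReal.mul_lt_top ENNReal.ofNat_lt_top (ENNReal.rpow_lt_top_of_nonneg (by norm_num)
        lintegral_sobolevWeight_neg_nine_lt_top.ne))) ENNReal.ofReal_lt_top) ENNReal.ofReal_lt_top
  have hS_top : S < ∞ := 𝒜.moment 0 0 0
  have hKS : Kpt * S ≠ ∞ := (ENNReal.mul_lt_top hKpt_top hS_top).ne
  refine ⟨(Kpt * S).toNNReal, fun f g h hg hh => ?_⟩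
  rw [ENNReal.coe_toNNReal hKS]
  set X : ℝ≥0∞ := ‖f‖ₑ * eFourierSobolevNorm 10 g * eFourierSobolevNorm 1 h with hX
  have hX_top : X < ∞ := ENNReal.mul_lt_top (ENNReal.mul_lt_top enorm_lt_top hg) hh
  have hKX : Kpt * X ≠ ∞ := (ENNReal.mul_lt_top hKpt_top hX_top).ne
  have hfin : Kpt * S * ‖f‖ₑ * eFourierSobolevNorm 10 g * eFourierSobolevNorm 1 h = Kpt * X * S := by
    rw [hX]
    ring
  rw [hfin]
  constructor
  · calc ‖𝒜.form f g h‖ₑ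
        ≤ ∫⁻ θ, ‖eulerForm (𝒜.slot 0 θ f) (𝒜.slot 1 θ g) (𝒜.slot 2 θ h)‖ₑ ∂𝒜.μ :=
          enorm_integral_le_lintegral_enorm _
      _ ≤ ∫⁻ θ, Kpt * X * (symbolSeminorm 0 (𝒜.m 0 θ) * symbolSeminorm 0 (𝒜.m 1 θ) *
            symbolSeminorm 0 (𝒜.m 2 θ)) ∂𝒜.μ :=
          lintegral_mono fun θ => (enorm_eulerForm_slot_le_one 𝒜 hC' f g h θ).1
      _ = Kpt * X * S := lintegral_const_mul' _ _ hKX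
  · calc ‖𝒜.form g f h‖ₑ
        ≤ ∫⁻ θ, ‖eulerForm (𝒜.slot 0 θ g) (𝒜.slot 1 θ f) (𝒜.slot 2 θ h)‖ₑ ∂𝒜.μ :=
          enorm_integral_le_lintegral_enorm _
      _ ≤ ∫⁻ θ, Kpt * X * (symbolSeminorm 0 (𝒜.m 0 θ) * symbolSeminorm 0 (𝒜.m 1 θ) *
            symbolSeminorm 0 (𝒜.m 2 θ)) ∂𝒜.μ :=
          lintegral_mono fun θ => (enorm_eulerForm_slot_le_one 𝒜 hC' f g h θ).2
      _ = Kpt * X * S := lintegral_const_mul' _ _ hKX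

end Summit.NavierStokesRegularity.NavierStokesRegularity.Theorems.PerpetualPumpThesis.U

namespace Summit.NavierStokesRegularity.NavierStokesRegularity.Theorems.PerpetualPumpThesis

open Literature.Analysis.FluidPDE Literature.Analysis.FluidPDE.Tao2016
open Literature.Analysis.FunctionSpaces (eFourierSobolevNorm)

/-- **Part FormBound of stub U (registered sub-goal `stub_uniqueness_FormBound`)**: the
`L² × H¹⁰ × H¹` bound for Tao's averaged form — for every averaging datum `𝒜` there is a finite
`K` with `|⟨B̃(f,g), h⟩| ≤ K ‖f‖_{L²} ‖g‖_{H¹⁰} ‖h‖_{H¹}` and `|⟨B̃(g,f), h⟩| ≤ K ‖f‖_{L²} ‖g‖_{H¹⁰} ‖h‖_{H¹}`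
for all `f ∈ L²(ℝ³; ℂ³)`, `g` of finite `H¹⁰` norm and `h` of finite `H¹` norm. -/
theorem stub_uniqueness_FormBound : ∀ 𝒜 : AveragingDatum, ∃ K : NNReal, ∀ f g h : L2C, eFourierSobolevNorm 10 g < ⊤ → eFourierSobolevNorm 1 h < ⊤ → ‖𝒜.form f g h‖ₑ ≤ (K : ENNReal) * ‖f‖ₑ * eFourierSobolevNorm 10 g * eFourierSobolevNorm 1 h ∧ ‖𝒜.form g f h‖ₑ ≤ (K : ENNReal) * ‖f‖ₑ * eFourierSobolevNorm 10 g * eFourierSobolevNorm 1 h :=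
  fun 𝒜 => U.exists_enorm_form_le_one 𝒜

end Summit.NavierStokesRegularity.NavierStokesRegularity.Theorems.PerpetualPumpThesis
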